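import Summits.Ventures.PercRepro.Conditioning

/-!
# Support of the product weight: sure edges, null events, almost-sure equality

* `weight_eq_zero_of_open_of_eq_zero` / `weight_eq_zero_of_closed_of_eq_one`: an edge with
  `p e = 0` is surely closed, an edge with `p e = 1` surely open.
* `prob_congr_of_support`: two events that agree on `{ω | weight p ω ≠ 0}` have the same
  probability ("equal almost surely").
* `prob_inter_closed_of_eq_zero`, `prob_inter_open_of_eq_one`, `prob_inter_cylinder_of_eq_zero`:
  intersecting with a sure event does not change the probability.
* `zeroOn p T`: the weight vector with the edges of `T` switched off (graph surgery without
  changing the edge type), with `isProb_zeroOn`, `zeroOn_apply_of_mem`, `zeroOn_apply_of_notMem`.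
* `keepOn p K` (the complementary vector: `p` on `K`, `0` off `K`) and **revealing an edge set**:
  `weight_keepOn_mul_weight_zeroOn` (the weight factorises along `K`) and the splitting
  identities `prob_eq_sum_keepOn` / `expect_eq_sum_keepOn`,
  `P_p(D) = ∑_ζ w_{keepOn p K}(ζ) · P_{zeroOn p K}{ω | ζ ⊔ ω ∈ D}` — condition on the states
  of the edges of `K`, then percolate on the rest (the induction step of van den Berg–Kahn-type
  arguments).  Section `KeepZero` is p1's (lean-drafts/p1/Reveal.lean,
  2026-08-22T01:41Z), absorbed verbatim into the canonical interface.
-/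

open Finset

namespace PercRepro

section Support

variable {E : Type*} [Fintype E] [DecidableEq E]

/-! ### Sure edges -/

omit [DecidableEq E] in
/-- If `p e = 0`, every configuration with `e` open has weight `0`. -/
theorem weight_eq_zero_of_open_of_eq_zero {p : E → ℝ} {e : E} (hpe : p e = 0) {ω : Config E}
    (hω : ω e = true) : weight p ω = 0 := by
  unfold weight
  exact Finset.prod_eq_zero (Finset.mem_univ e) (by simp [hω, hpe])

omit [DecidableEq E] in
/-- If `p e = 1`, every configuration with `e` closed has weight `0`. -/
theorem weight_eq_zero_of_closed_of_eq_one {p : E → ℝ} {e : E} (hpe : p e = 1) {ω : Config E}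
    (hω : ω e = false) : weight p ω = 0 := by
  unfold weight
  exact Finset.prod_eq_zero (Finset.mem_univ e) (by simp [hω, hpe])

omit [DecidableEq E] in
/-- On the support of the weight, open edges have `p e ≠ 0`. -/
theorem ne_zero_of_weight_ne_zero_of_open {p : E → ℝ} {ω : Config E} (h : weight p ω ≠ 0)
    {e : E} (hω : ω e = true) : p e ≠ 0 :=
  fun hpe => h (weight_eq_zero_of_open_of_eq_zero hpe hω)

omit [DecidableEq E] in
/-- On the support of the weight, closed edges have `p e ≠ 1`. -/
theorem ne_one_of_weight_ne_zero_of_closed {p : E → ℝ} {ω : Config E} (h : weight p ω ≠ 0)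
    {e : E} (hω : ω e = false) : p e ≠ 1 :=
  fun hpe => h (weight_eq_zero_of_closed_of_eq_one hpe hω)

omit [DecidableEq E] in
/-- On the support of the weight, an edge with `p e = 0` is closed. -/
theorem eq_false_of_weight_ne_zero_of_eq_zero {p : E → ℝ} {ω : Config E} (h : weight p ω ≠ 0)
    {e : E} (hpe : p e = 0) : ω e = false := by
  cases hω : ω e
  · rfl
  · exact absurd (weight_eq_zero_of_open_of_eq_zero hpe hω) h

omit [DecidableEq E] in
/-- On the support of the weight, an edge with `p e = 1` is open. -/
theorem eq_true_of_weight_ne_zero_of_eq_one {p : E → ℝ} {ω : Config E} (h : weight p ω ≠ 0)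
    {e : E} (hpe : p e = 1) : ω e = true := by
  cases hω : ω e
  · exact absurd (weight_eq_zero_of_closed_of_eq_one hpe hω) h
  · rfl

/-! ### Almost-sure equality of events -/

/-- Events that agree on the support of the weight have the same probability. -/
theorem prob_congr_of_support (p : E → ℝ) {A B : Set (Config E)}
    (h : ∀ ω, weight p ω ≠ 0 → (ω ∈ A ↔ ω ∈ B)) : prob p A = prob p B := by
  unfold prob
  refine Finset.sum_congr rfl fun ω _ => ?_
  by_cases hw : weight p ω = 0
  · by_cases hA : ω ∈ A <;> by_cases hB : ω ∈ B <;> simp [Set.indicator, hA, hB, hw]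
  · have hAB := h ω hw
    by_cases hA : ω ∈ A
    · rw [Set.indicator_of_mem hA, Set.indicator_of_mem (hAB.1 hA)]
    · rw [Set.indicator_of_notMem hA, Set.indicator_of_notMem fun hB => hA (hAB.2 hB)]

/-- An event on which the weight vanishes is null. -/
theorem prob_eq_zero_of_forall_weight_eq_zero (p : E → ℝ) {A : Set (Config E)}
    (h : ∀ ω ∈ A, weight p ω = 0) : prob p A = 0 := by
  rw [← prob_empty p]
  exact prob_congr_of_support p fun ω hw =>
    ⟨fun hA => absurd (h ω hA) hw, fun h => h.elim⟩

/-- An event containing the support of the weight is sure. -/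
theorem prob_eq_one_of_forall_mem (p : E → ℝ) {A : Set (Config E)}
    (h : ∀ ω, weight p ω ≠ 0 → ω ∈ A) : prob p A = 1 := by
  rw [← prob_univ p]
  exact prob_congr_of_support p fun ω hw => ⟨fun _ => trivial, fun _ => h ω hw⟩

/-- If `p e = 0`, the event `{e closed}` is sure. -/
theorem prob_inter_closed_of_eq_zero {p : E → ℝ} {e : E} (hpe : p e = 0) (A : Set (Config E)) :
    prob p (A ∩ {ω | ω e = false}) = prob p A :=
  prob_congr_of_support p fun ω hw => by
    simp [eq_false_of_weight_ne_zero_of_eq_zero hw hpe]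

/-- If `p e = 1`, the event `{e open}` is sure. -/
theorem prob_inter_open_of_eq_one {p : E → ℝ} {e : E} (hpe : p e = 1) (A : Set (Config E)) :
    prob p (A ∩ {ω | ω e = true}) = prob p A :=
  prob_congr_of_support p fun ω hw => by
    simp [eq_true_of_weight_ne_zero_of_eq_one hw hpe]

/-- If `p` vanishes on the edge set `T`, the cylinder "`T` closed" is sure. -/
theorem prob_inter_cylinder_of_eq_zero {p : E → ℝ} {T : Finset E} (hT : ∀ e ∈ T, p e = 0)
    (A : Set (Config E)) : prob p (A ∩ cylinder ∅ T) = prob p A :=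
  prob_congr_of_support p fun ω hw => by
    simp only [Set.mem_inter_iff, mem_cylinder, Finset.notMem_empty, false_imp_iff,
      implies_true, true_and, and_iff_left_iff_imp]
    intro _ e he
    exact eq_false_of_weight_ne_zero_of_eq_zero hw (hT e he)

/-- If `p e = 0`, an event whose occurrence depends on `ω` only through the configurations with
`e` closed has the probability of its closed-trace. -/
theorem prob_congr_of_eq_zero {p : E → ℝ} {e : E} (hpe : p e = 0) {A B : Set (Config E)}
    (h : ∀ ω : Config E, ω e = false → (ω ∈ A ↔ ω ∈ B)) : prob p A = prob p B :=
  prob_congr_of_support p fun ω hw => h ω (eq_false_of_weight_ne_zero_of_eq_zero hw hpe)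

/-! ### Switching off a set of edges -/

/-- `zeroOn p T`: the weight vector `p` with the edges of `T` switched off (`p e = 0` on `T`).
This is "deleting the edges of `T`" without changing the edge type. -/
def zeroOn (p : E → ℝ) (T : Finset E) : E → ℝ := fun e => if e ∈ T then 0 else p e

omit [Fintype E] in
/-- `zeroOn p T` vanishes on `T`. -/
theorem zeroOn_apply_of_mem (p : E → ℝ) {T : Finset E} {e : E} (he : e ∈ T) :
    zeroOn p T e = 0 := by
  simp [zeroOn, he]

omit [Fintype E] in
/-- `zeroOn p T` agrees with `p` off `T`. -/
theorem zeroOn_apply_of_notMem (p : E → ℝ) {T : Finset E} {e : E} (he : e ∉ T) :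
    zeroOn p T e = p e := by
  simp [zeroOn, he]

omit [Fintype E] in
/-- Switching edges off preserves `IsProb`. -/
theorem isProb_zeroOn {p : E → ℝ} (hp : IsProb p) (T : Finset E) : IsProb (zeroOn p T) := by
  intro e
  by_cases he : e ∈ T
  · simp [zeroOn_apply_of_mem p he]
  · rw [zeroOn_apply_of_notMem p he]
    exact hp e

omit [Fintype E] in
/-- `zeroOn p T ≤ p` pointwise when `p` is a probability vector. -/
theorem zeroOn_le {p : E → ℝ} (hp : IsProb p) (T : Finset E) : zeroOn p T ≤ p := by
  intro e
  by_cases he : e ∈ T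
  · rw [zeroOn_apply_of_mem p he]
    exact hp.nonneg e
  · rw [zeroOn_apply_of_notMem p he]

omit [Fintype E] in
/-- Switching off no edge does nothing. -/
theorem zeroOn_empty (p : E → ℝ) : zeroOn p ∅ = p := by
  funext e
  simp [zeroOn]

/-- Under `zeroOn p T`, every configuration with an open edge in `T` has weight `0`. -/
theorem weight_zeroOn_eq_zero {p : E → ℝ} {T : Finset E} {ω : Config E} {e : E} (he : e ∈ T)
    (hω : ω e = true) : weight (zeroOn p T) ω = 0 :=
  weight_eq_zero_of_open_of_eq_zero (zeroOn_apply_of_mem p he) hω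

/-- Under `zeroOn p T`, the cylinder "`T` closed" is sure. -/
theorem prob_zeroOn_inter_cylinder (p : E → ℝ) (T : Finset E) (A : Set (Config E)) :
    prob (zeroOn p T) (A ∩ cylinder ∅ T) = prob (zeroOn p T) A :=
  prob_inter_cylinder_of_eq_zero (fun _ he => zeroOn_apply_of_mem p he) A

/-- Monotonicity under switching edges off, increasing events:
`P_{zeroOn p T}(A) ≤ P_p(A)`. -/
theorem prob_zeroOn_le_of_isUpperSet {p : E → ℝ} (hp : IsProb p) (T : Finset E)
    {A : Set (Config E)} (hA : IsUpperSet A) : prob (zeroOn p T) A ≤ prob p A :=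
  prob_mono_of_isUpperSet (isProb_zeroOn hp T) hp (zeroOn_le hp T) hA

end Support

/-! ### Edge probabilities kept on an edge set; revealing the edges of `K` -/

section KeepZero

variable {E : Type*} [DecidableEq E]

/-- `keepOn p K`: the edge probabilities `p` on the edges of `K`, and `0` off `K` (the
complement of `zeroOn p K`: `keepOn p K` keeps exactly the edges that `zeroOn p K` switches
off). -/
def keepOn (p : E → ℝ) (K : Finset E) : E → ℝ := fun e => if e ∈ K then p e else 0

/-- `keepOn p K` agrees with `p` on `K`. -/
@[simp] theorem keepOn_apply_of_mem (p : E → ℝ) {K : Finset E} {e : E} (he : e ∈ K) :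
    keepOn p K e = p e := by simp [keepOn, he]

/-- `keepOn p K` vanishes off `K`. -/
@[simp] theorem keepOn_apply_of_notMem (p : E → ℝ) {K : Finset E} {e : E} (he : e ∉ K) :
    keepOn p K e = 0 := by simp [keepOn, he]

/-- `keepOn p K` is a probability vector when `p` is. -/
theorem isProb_keepOn {p : E → ℝ} (hp : IsProb p) (K : Finset E) : IsProb (keepOn p K) := by
  intro e
  by_cases he : e ∈ K
  · simp [he, hp e]
  · simp [he]

variable [Fintype E]

/-- A configuration with an open edge off `K` has `keepOn p K`-weight `0`. -/
theorem weight_keepOn_eq_zero {p : E → ℝ} {K : Finset E} {ζ : Config E} {e : E} (he : e ∉ K)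
    (hζ : ζ e = true) : weight (keepOn p K) ζ = 0 :=
  weight_eq_zero_of_open_of_eq_zero (keepOn_apply_of_notMem p he) hζ

/-- A configuration of nonzero `keepOn p K`-weight is closed off `K`. -/
theorem closedOff_of_weight_keepOn_ne_zero {p : E → ℝ} {K : Finset E} {ζ : Config E}
    (h : weight (keepOn p K) ζ ≠ 0) : ∀ e ∉ K, ζ e = false :=
  fun _ he => eq_false_of_weight_ne_zero_of_eq_zero h (keepOn_apply_of_notMem p he)

/-- A configuration of nonzero `zeroOn p K`-weight is closed on `K`. -/
theorem closedOn_of_weight_zeroOn_ne_zero {p : E → ℝ} {K : Finset E} {ω : Config E}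
    (h : weight (zeroOn p K) ω ≠ 0) : ∀ e ∈ K, ω e = false :=
  fun _ he => eq_false_of_weight_ne_zero_of_eq_zero h (zeroOn_apply_of_mem p he)

/-- **Factorisation of the weight** along an edge set: for `ζ` closed off `K` and `ω` closed
on `K`, `w_{keepOn p K}(ζ) · w_{zeroOn p K}(ω) = w_p(ζ ⊔ ω)`. -/
theorem weight_keepOn_mul_weight_zeroOn (p : E → ℝ) (K : Finset E) {ζ ω : Config E}
    (hζ : ∀ e ∉ K, ζ e = false) (hω : ∀ e ∈ K, ω e = false) :
    weight (keepOn p K) ζ * weight (zeroOn p K) ω = weight p (ζ ⊔ ω) := by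
  unfold weight
  rw [← Finset.prod_mul_prod_compl K (fun e => if ζ e then keepOn p K e else 1 - keepOn p K e),
    ← Finset.prod_mul_prod_compl K (fun e => if ω e then zeroOn p K e else 1 - zeroOn p K e),
    ← Finset.prod_mul_prod_compl K (fun e => if (ζ ⊔ ω) e then p e else 1 - p e)]
  have h1 : ∏ e ∈ Kᶜ, (if ζ e then keepOn p K e else 1 - keepOn p K e) = 1 := by
    refine Finset.prod_eq_one fun e he => ?_
    rw [Finset.mem_compl] at he
    simp [hζ e he, he]
  have h2 : ∏ e ∈ K, (if ω e then zeroOn p K e else 1 - zeroOn p K e) = 1 := by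
    refine Finset.prod_eq_one fun e he => ?_
    simp [hω e he, zeroOn_apply_of_mem p he]
  have h3 : ∏ e ∈ K, (if ζ e then keepOn p K e else 1 - keepOn p K e) =
      ∏ e ∈ K, (if (ζ ⊔ ω) e then p e else 1 - p e) := by
    refine Finset.prod_congr rfl fun e he => ?_
    simp [he, Pi.sup_apply, hω e he]
  have h4 : ∏ e ∈ Kᶜ, (if ω e then zeroOn p K e else 1 - zeroOn p K e) =
      ∏ e ∈ Kᶜ, (if (ζ ⊔ ω) e then p e else 1 - p e) := by
    refine Finset.prod_congr rfl fun e he => ?_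
    rw [Finset.mem_compl] at he
    simp [zeroOn_apply_of_notMem p he, Pi.sup_apply, hζ e he]
  rw [h1, h2, h3, h4]
  ring

/-- **Splitting the measure along an edge set**: revealing the configuration `ζ` of the edges of
`K` (weight `w_{keepOn p K}(ζ)`, supported on configurations closed off `K`) and then
percolating on the remaining edges with `zeroOn p K`,
`P_p(D) = ∑_ζ w_{keepOn p K}(ζ) · P_{zeroOn p K}{ω | ζ ⊔ ω ∈ D}`. -/
theorem prob_eq_sum_keepOn (p : E → ℝ) (K : Finset E) (D : Set (Config E)) :
    prob p D = ∑ ζ, weight (keepOn p K) ζ * prob (zeroOn p K) {ω | ζ ⊔ ω ∈ D} := by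
  classical
  have hterm : ∀ ζ ω : Config E,
      weight (keepOn p K) ζ * {ω | ζ ⊔ ω ∈ D}.indicator (weight (zeroOn p K)) ω =
        if (∀ e ∉ K, ζ e = false) ∧ (∀ e ∈ K, ω e = false) then
          D.indicator (weight p) (ζ ⊔ ω) else 0 := by
    intro ζ ω
    by_cases hs : (∀ e ∉ K, ζ e = false) ∧ (∀ e ∈ K, ω e = false)
    · rw [if_pos hs]
      by_cases hD : ζ ⊔ ω ∈ D
      · have hD' : ω ∈ {ω | ζ ⊔ ω ∈ D} := hD
        simp only [Set.indicator_of_mem hD', Set.indicator_of_mem hD]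
        exact weight_keepOn_mul_weight_zeroOn p K hs.1 hs.2
      · have hD' : ω ∉ {ω | ζ ⊔ ω ∈ D} := hD
        simp only [Set.indicator_of_notMem hD', Set.indicator_of_notMem hD, mul_zero]
    · rw [if_neg hs]
      rcases not_and_or.1 hs with hs | hs
      · simp only [not_forall, exists_prop] at hs
        obtain ⟨e, he, hζ⟩ := hs
        rw [weight_keepOn_eq_zero he (by simpa using hζ), zero_mul]
      · simp only [not_forall, exists_prop] at hs
        obtain ⟨e, he, hω⟩ := hs
        have h0 : weight (zeroOn p K) ω = 0 := weight_zeroOn_eq_zero he (by simpa using hω)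
        simp [Set.indicator, h0]
  set T : Finset (Config E × Config E) :=
    univ.filter (fun x => (∀ e ∉ K, x.1 e = false) ∧ (∀ e ∈ K, x.2 e = false)) with hT
  calc prob p D = ∑ η, D.indicator (weight p) η := rfl
    _ = ∑ x ∈ T, D.indicator (weight p) (x.1 ⊔ x.2) := by
        symm
        refine Finset.sum_nbij' (fun x => x.1 ⊔ x.2)
          (fun η => (fun e => if e ∈ K then η e else false, fun e => if e ∈ K then false else η e))
          (fun _ _ => Finset.mem_univ _) ?_ ?_ ?_ (fun _ _ => rfl)
        · intro η _
          simp only [hT, Finset.mem_filter, Finset.mem_univ, true_and]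
          exact ⟨fun e he => by simp [he], fun e he => by simp [he]⟩
        · intro x hx
          simp only [hT, Finset.mem_filter, Finset.mem_univ, true_and] at hx
          refine Prod.ext (funext fun e => ?_) (funext fun e => ?_)
          · by_cases he : e ∈ K
            · simp [he, Pi.sup_apply, hx.2 e he]
            · simp [he, hx.1 e he]
          · by_cases he : e ∈ K
            · simp [he, hx.2 e he]
            · simp [he, Pi.sup_apply, hx.1 e he]
        · intro η _
          funext e
          by_cases he : e ∈ K <;> simp [he, Pi.sup_apply]
    _ = ∑ x ∈ (univ : Finset (Config E × Config E)),
          if (∀ e ∉ K, x.1 e = false) ∧ (∀ e ∈ K, x.2 e = false) then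
            D.indicator (weight p) (x.1 ⊔ x.2) else 0 := Finset.sum_filter _ _
    _ = ∑ ζ, ∑ ω, (if (∀ e ∉ K, ζ e = false) ∧ (∀ e ∈ K, ω e = false) then
          D.indicator (weight p) (ζ ⊔ ω) else 0) := by
        rw [← Finset.univ_product_univ, Finset.sum_product]
    _ = ∑ ζ, ∑ ω, weight (keepOn p K) ζ * {ω | ζ ⊔ ω ∈ D}.indicator (weight (zeroOn p K)) ω := by
        simp only [hterm]
    _ = ∑ ζ, weight (keepOn p K) ζ * prob (zeroOn p K) {ω | ζ ⊔ ω ∈ D} := by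
        simp only [prob, Finset.mul_sum]

/-- Functions that agree on the support of the weight have the same expectation. -/
theorem expect_congr_of_support (p : E → ℝ) {F F' : Config E → ℝ}
    (h : ∀ ω, weight p ω ≠ 0 → F ω = F' ω) : expect p F = expect p F' := by
  unfold expect
  refine Finset.sum_congr rfl fun ω _ => ?_
  by_cases hw : weight p ω = 0
  · rw [hw, zero_mul, zero_mul]
  · rw [h ω hw]

/-- **Splitting the expectation along an edge set**: revealing the configuration `ζ` of the edges
of `K` (weight `w_{keepOn p K}(ζ)`, supported on configurations closed off `K`) and then
percolating on the remaining edges with `zeroOn p K`,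
`E_p[F] = ∑_ζ w_{keepOn p K}(ζ) · E_{zeroOn p K}[F(ζ ⊔ ·)]`. -/
theorem expect_eq_sum_keepOn (p : E → ℝ) (K : Finset E) (F : Config E → ℝ) :
    expect p F = ∑ ζ, weight (keepOn p K) ζ * expect (zeroOn p K) (fun ω => F (ζ ⊔ ω)) := by
  classical
  have hterm : ∀ ζ ω : Config E,
      weight (keepOn p K) ζ * (weight (zeroOn p K) ω * F (ζ ⊔ ω)) =
        if (∀ e ∉ K, ζ e = false) ∧ (∀ e ∈ K, ω e = false) then
          weight p (ζ ⊔ ω) * F (ζ ⊔ ω) else 0 := by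
    intro ζ ω
    by_cases hs : (∀ e ∉ K, ζ e = false) ∧ (∀ e ∈ K, ω e = false)
    · rw [if_pos hs, ← mul_assoc, weight_keepOn_mul_weight_zeroOn p K hs.1 hs.2]
    · rw [if_neg hs]
      rcases not_and_or.1 hs with hs | hs
      · simp only [not_forall, exists_prop] at hs
        obtain ⟨e, he, hζ⟩ := hs
        rw [weight_keepOn_eq_zero he (by simpa using hζ), zero_mul]
      · simp only [not_forall, exists_prop] at hs
        obtain ⟨e, he, hω⟩ := hs
        rw [weight_zeroOn_eq_zero he (by simpa using hω), zero_mul, mul_zero]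
  set T : Finset (Config E × Config E) :=
    univ.filter (fun x => (∀ e ∉ K, x.1 e = false) ∧ (∀ e ∈ K, x.2 e = false)) with hT
  calc expect p F = ∑ η, weight p η * F η := rfl
    _ = ∑ x ∈ T, weight p (x.1 ⊔ x.2) * F (x.1 ⊔ x.2) := by
        symm
        refine Finset.sum_nbij' (fun x => x.1 ⊔ x.2)
          (fun η => (fun e => if e ∈ K then η e else false, fun e => if e ∈ K then false else η e))
          (fun _ _ => Finset.mem_univ _) ?_ ?_ ?_ (fun _ _ => rfl)
        · intro η _
          simp only [hT, Finset.mem_filter, Finset.mem_univ, true_and]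
          exact ⟨fun e he => by simp [he], fun e he => by simp [he]⟩
        · intro x hx
          simp only [hT, Finset.mem_filter, Finset.mem_univ, true_and] at hx
          refine Prod.ext (funext fun e => ?_) (funext fun e => ?_)
          · by_cases he : e ∈ K
            · simp [he, Pi.sup_apply, hx.2 e he]
            · simp [he, hx.1 e he]
          · by_cases he : e ∈ K
            · simp [he, hx.2 e he]
            · simp [he, Pi.sup_apply, hx.1 e he]
        · intro η _
          funext e
          by_cases he : e ∈ K <;> simp [he, Pi.sup_apply]
    _ = ∑ x ∈ (univ : Finset (Config E × Config E)),
          if (∀ e ∉ K, x.1 e = false) ∧ (∀ e ∈ K, x.2 e = false) then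
            weight p (x.1 ⊔ x.2) * F (x.1 ⊔ x.2) else 0 := Finset.sum_filter _ _
    _ = ∑ ζ, ∑ ω, (if (∀ e ∉ K, ζ e = false) ∧ (∀ e ∈ K, ω e = false) then
          weight p (ζ ⊔ ω) * F (ζ ⊔ ω) else 0) := by
        rw [← Finset.univ_product_univ, Finset.sum_product]
    _ = ∑ ζ, ∑ ω, weight (keepOn p K) ζ * (weight (zeroOn p K) ω * F (ζ ⊔ ω)) := by
        simp only [hterm]
    _ = ∑ ζ, weight (keepOn p K) ζ * expect (zeroOn p K) (fun ω => F (ζ ⊔ ω)) := by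
        simp only [expect, Finset.mul_sum]

end KeepZero

end PercRepro
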